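/-
Copyright (c) 2026 the pub-hodgecm-mathlib formalisation cell (harness21).  Prover seat hodgecm-mathlib-LH4-p02 (g5), 2026-09-02: «NORM-ONE INDEX TRANSPORT» (name LH4-plan (g5)
WORD #16; wild base layer of the (D-RAM) column, over ★ `RamifiedPlaceNormOneTorus`, next to the MARS index).
-/
import Literature.NumberTheory.Automorphic.RamifiedPlaceNormOneTorus   -- ★ p851075: Hilbert 90 dress, `exists_eq_div_or_of_norm_one`, `exists_eq_div_of_norm_one_of_valued_sub_one_le`, `valued_div_galAdicCompletionMap_sub_one_le_iff`, …
import Literature.NumberTheory.Automorphic.RamifiedPlaceOrderUnitIndex  -- ★ p851113 LH4-p01 (g4) (ED. 2): the MARS index `relIndex_eq_pow_of_sigmaDepth` `[U : V_j] = q_v^j`, `exists_subgroup_units_valued_eq_one`, `exists_subgroup_sigmaDepth`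
import HarnessLib

/-!
# NORM-ONE INDEX TRANSPORT at a ramified CM place: `[T⁽ᵈ⁾ : T_c] = [U : V_c]` for the norm-one torus `T` and the σ-depth balls of units, and `[T : T⁽ᵈ⁾] = 2`
# (any residue characteristic; Flicker 1998 Prop. 7 (b) ⇐ (a); Serre, *Local Fields* V §3, X §1)

Topic `NumberTheory/Automorphic`; namespace `Literature.NumberTheory.Automorphic.UnitaryGroup`.  THEOREMS ONLY (no definition, no instance, no notation, no named fact,
no `sorry`; axioms ⊆ {propext, Classical.choice, Quot.sound}).  Cell `pub/hodgecm-mathlib` (D-0151), crux H413 = `stmt-HodgeConjecture-24833`; half A line LH4, DYADIC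
pay-down leaf `Cruxes/H413/Lines/F0_P3c_DyadicPaydown.lean`, organ (D-RAM) (PRINT by ruling D74′; scope audit LH4-plan (g5) b4c7662647f1db69 «COVERED at v ∣ 2»).  HONEST
READER LABEL: BANKED base layer, consumers none live; HC_CM is proved only modulo the 7 printed citations (2 remaining named inputs: hLiu418 = stmt-HodgeConjecture-24832,
h413 = stmt-HodgeConjecture-24833) until rung 0 closes; unconditional local algebra + group theory, count-neutral, pays no letter by itself.

SETTING (= ★ `RamifiedPlaceNormOneTorus`): `L` CM, `w ∣ v` with `c • w = w`, `e(w|v) ≠ 1`; `E := L_w`, `σ = σ_w`, `ι = toPlace v w`, `τ` a uniformiser, `D := |στ − τ|`.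
Subgroups of `Eˣ` are HYPOTHESIS-CHARACTERISED (no definitions), in the letters of the MARS index file (`RamifiedPlaceOrderUnitIndex`, LH4-p01): `U = {|u| = 1}`,
`V = {|u| = 1, |σu − u| ≤ c}` (σ-depth ball; `c = exp(−2j)·D` is the unit group of the conductor-`j` order, ★ `RamifiedPlaceSigmaDepth`), `T = {σt·t = 1}` (norm-one torus),
`T₀ = T⁽ᵈ⁾ = {σt·t = 1, |t − 1| ≤ D}`, `T₁ = T_c = {σt·t = 1, |t − 1| ≤ c}`; their existence as subgroups: §1 here (T-side) and MARS §2 (U, V).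
* §1 `exists_subgroup_normOne`, `exists_subgroup_normOne_depth` — the norm-one torus and its depth balls ARE subgroups of `Eˣ` (ultrametric closure).
* §2 **`relIndex_normOne_eq_relIndex_sigmaDepth_of_le`**: for `c ≤ D`, `T₁.relIndex T₀ = V.relIndex U` — i.e. `[T⁽ᵈ⁾ : T_c] = [U : V_c]`.  PROOF: the hom `f : ↥U → Eˣ`,
  `u ↦ u∕σu` (★ `mul_div_galAdicCompletionMap_mul`; built inside the proof, no definition) has `f(U) = T₀` (★ `exists_eq_div_of_norm_one_of_valued_sub_one_le` ∕ ★
  `valued_div_galAdicCompletionMap_sub_one_le_of_valued_eq_one`), `f(V) = T₁` (★ `valued_div_galAdicCompletionMap_sub_one_le_iff`) and `ker f` = the σ-FIXED units `⊆ V`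
  (σ-depth `0`); Mathlib's TRANSPORT `Subgroup.relIndex_map_map` (`(map f H).relIndex (map f K) = (H ⊔ ker f).relIndex (K ⊔ ker f)`) with `H = V.subgroupOf U`, `K = ⊤`
  finishes (`f` is restricted to `↥U` FIRST: on all of `Eˣ` the kernel `ι(L⁺_vˣ)` is not inside `U` and the transport would pick up an infinite cofactor).  MARS-LETTER
  instance **`relIndex_normOne_eq_relIndex_sigmaDepth`** (`c = exp(−2j)·D`): `[T⁽ᵈ⁾ : T⁽ᵈ⁺²ʲ⁾] = [U : V_j]`; with the MARS index `[U : V_j] = q_v^j` this is Flicker's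
  Prop. 7 (b) `[R_E¹ : R_E(j)¹] = q^j` at ANY residue characteristic (that 3-line corollary is NOT here — it waits for the MARS file).  Reader's form of the image
  identity: `mem_normOne_depth_iff_exists_unit`.
* §3 **`relIndex_normOne_depth_eq_two`**: `T₀.relIndex T = 2` — `[T : T⁽ᵈ⁾] = 2`, the Hilbert-90 index: by ★ `exists_eq_div_or_of_norm_one` every `b ∈ T` is `u∕σu` (in `T₀`)
  or `u∕σu · a` with `a = τ∕στ` (depth `d − 1`, not in `T₀`), and `b·a` switches the kind since `σa = a⁻¹` gives `(u∕σu)·a·a = (ua)∕σ(ua)` (Mathlib `Subgroup.relIndex_eq_two_iff`).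
* §4 (ED. 2, over the MARS index ★ `RamifiedPlaceOrderUnitIndex`, LH4-p01 (g4)) **`relIndex_normOne_eq_pow`**: `Tj.relIndex T₀ = q_v^j` — `[T⁽ᵈ⁾ : T⁽ᵈ⁺²ʲ⁾] = q_v^j`, FLICKER'S
  PROP. 7 (b) AT ANY RESIDUE CHARACTERISTIC (the unit groups do not appear in the statement); `relIndex_normOne_eq_absNorm_pow` (`#(𝓞_{L⁺}∕v)^j`);
  **`relIndex_normOne_top_eq_two_mul_pow`**: `[T : T⁽ᵈ⁺²ʲ⁾] = 2·q_v^j`; the package `exists_subgroups_normOne_relIndex`.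

## References
* [Serre1979] J.-P. Serre, *Local Fields*, GTM 67 (1979): Ch. V §3 (filtration of units and norms, totally ramified case), Ch. X §1 Prop. 2 (Hilbert 90), Ch. IV §1–§2.
* [Flicker1998UnitaryFL] Y. Z. Flicker, *Elementary proof of the fundamental lemma for a unitary group*, Canad. J. Math. 50 (1998), Prop. 7 p. 84 ((a) `[R_E^× : R_E(j)^×] = q^j`,
  (b) `[R_E¹ : R_E(j)¹] = q^j`; there `p > 2`, here any residue characteristic).
-/

set_option autoImplicit false

noncomputable section

open NumberField IsDedekindDomain ValuativeRel
open scoped ValuativeRel WithZero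

namespace Literature.NumberTheory.Automorphic.UnitaryGroup

variable (L : Type) [Field L] [NumberField L] [IsCMField L] (v : HeightOneSpectrum (𝓞 ↥(maximalRealSubfield L)))
  (w : PlacesOver L v) (hw : IsCMField.complexConj L • w.1 = w.1) (he : v.asIdeal.ramificationIdx' w.1.asIdeal ≠ 1)

/-! ## §0 Scalars (private) -/

/-- `σ_w σ_w = 1` on `L_w`. [cite: Serre1979, Ch. IV §2] -/
private theorem galAdicCompletionMap_galAdicCompletionMap'' (x : w.1.adicCompletion L) :
    galAdicCompletionMap (L := L) (IsCMField.complexConj L) hw (galAdicCompletionMap (L := L) (IsCMField.complexConj L) hw x) = x :=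
  galAdicCompletionMap_galAdicCompletionMap_of_smul_eq (IsCMField.complexConj L) w (IsCMField.complexConj_ne_one L) hw x

/-- Norm one forces valuation one (`σ_w` is isometric). [cite: Serre1979, Ch. V §3] -/
private theorem valued_eq_one_of_norm_one' {t : w.1.adicCompletion L} (ht : galAdicCompletionMap (L := L) (IsCMField.complexConj L) hw t * t = 1) : Valued.v t = 1 := by
  have h : Valued.v (galAdicCompletionMap (L := L) (IsCMField.complexConj L) hw t * t) = 1 := by rw [ht, map_one]
  rw [map_mul, valued_galAdicCompletionMap, ← pow_two] at h
  exact eq_of_sq_eq_sq (by rw [h, one_pow])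

/-- In `ℤᵐ⁰`: `x < x · exp 1` for `x ≠ 0`. [cite: Serre1979, Ch. II §1] -/
private theorem lt_mul_exp_one' {x : WithZero (Multiplicative ℤ)} (hx : x ≠ 0) : x < x * WithZero.exp (1 : ℤ) := by
  obtain ⟨m, hm⟩ : ∃ m : ℤ, x = WithZero.exp m := ⟨_, (WithZero.exp_log hx).symm⟩
  rw [hm, ← WithZero.exp_add, WithZero.exp_lt_exp]; omega

/-! ## §1 The norm-one torus and its depth balls are subgroups of `L_wˣ` -/

/-- **THE NORM-ONE TORUS IS A SUBGROUP of `L_wˣ`**: `∃ T ≤ L_wˣ, t ∈ T ↔ σt · t = 1`. [cite: Serre1979, Ch. X §1] -/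
theorem exists_subgroup_normOne :
    ∃ T : Subgroup (w.1.adicCompletion L)ˣ, ∀ t : (w.1.adicCompletion L)ˣ,
      t ∈ T ↔ galAdicCompletionMap (L := L) (IsCMField.complexConj L) hw (t : w.1.adicCompletion L) * t = 1 := by
  refine ⟨{ carrier := setOf fun t : (w.1.adicCompletion L)ˣ =>
              galAdicCompletionMap (L := L) (IsCMField.complexConj L) hw (t : w.1.adicCompletion L) * t = 1
            mul_mem' := ?_
            one_mem' := ?_
            inv_mem' := ?_ }, fun t => Iff.rfl⟩
  · intro a b ha hb
    simp only [Set.mem_setOf_eq, Units.val_mul, map_mul] at ha hb ⊢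
    calc _ = (galAdicCompletionMap (L := L) (IsCMField.complexConj L) hw (a : w.1.adicCompletion L) * a) *
          (galAdicCompletionMap (L := L) (IsCMField.complexConj L) hw (b : w.1.adicCompletion L) * b) := by ring
      _ = 1 := by rw [ha, hb, one_mul]
  · simp only [Set.mem_setOf_eq, Units.val_one, map_one, one_mul]
  · intro a ha
    simp only [Set.mem_setOf_eq, Units.val_inv_eq_inv_val, map_inv₀] at ha ⊢
    rw [← mul_inv, ha, inv_one]

/-- **THE DEPTH BALLS OF THE NORM-ONE TORUS ARE SUBGROUPS**: for any `c ∈ ℤᵐ⁰`, `∃ T_c ≤ L_wˣ, t ∈ T_c ↔ σt · t = 1 ∧ |t − 1| ≤ c` (ultrametric: `ab − 1 = a(b − 1) + (a − 1)`,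
`a⁻¹ − 1 = −(a − 1)·a⁻¹`, `|a| = 1`). [cite: Serre1979, Ch. V §3] [cite: Flicker1998UnitaryFL, Prop. 7 p. 84] -/
theorem exists_subgroup_normOne_depth (c : WithZero (Multiplicative ℤ)) :
    ∃ T : Subgroup (w.1.adicCompletion L)ˣ, ∀ t : (w.1.adicCompletion L)ˣ,
      t ∈ T ↔ galAdicCompletionMap (L := L) (IsCMField.complexConj L) hw (t : w.1.adicCompletion L) * t = 1 ∧
        Valued.v ((t : w.1.adicCompletion L) - 1) ≤ c := by
  refine ⟨{ carrier := setOf fun t : (w.1.adicCompletion L)ˣ =>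
              galAdicCompletionMap (L := L) (IsCMField.complexConj L) hw (t : w.1.adicCompletion L) * t = 1 ∧ Valued.v ((t : w.1.adicCompletion L) - 1) ≤ c
            mul_mem' := ?_
            one_mem' := ?_
            inv_mem' := ?_ }, fun t => Iff.rfl⟩
  · rintro a b ⟨ha, ha'⟩ ⟨hb, hb'⟩
    have hav : Valued.v (a : w.1.adicCompletion L) = 1 := valued_eq_one_of_norm_one' L v w hw ha
    refine ⟨?_, ?_⟩
    · rw [Units.val_mul, map_mul]
      calc _ = (galAdicCompletionMap (L := L) (IsCMField.complexConj L) hw (a : w.1.adicCompletion L) * a) *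
            (galAdicCompletionMap (L := L) (IsCMField.complexConj L) hw (b : w.1.adicCompletion L) * b) := by ring
        _ = 1 := by rw [ha, hb, one_mul]
    · rw [Units.val_mul, show (a : w.1.adicCompletion L) * b - 1 = a * (b - 1) + (a - 1) by ring]
      refine (Valuation.map_add _ _ _).trans (max_le ?_ ha')
      rw [map_mul, hav, one_mul]; exact hb'
  · refine ⟨by rw [Units.val_one, map_one, one_mul], ?_⟩
    rw [Units.val_one, sub_self, map_zero]; exact zero_le
  · rintro a ⟨ha, ha'⟩
    have hav : Valued.v (a : w.1.adicCompletion L) = 1 := valued_eq_one_of_norm_one' L v w hw ha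
    refine ⟨by rw [Units.val_inv_eq_inv_val, map_inv₀, ← mul_inv, ha, inv_one], ?_⟩
    have h : ((a : w.1.adicCompletion L))⁻¹ - 1 = -(a - 1) * ((a : w.1.adicCompletion L))⁻¹ := by
      field_simp; ring
    rw [Units.val_inv_eq_inv_val, h, map_mul, Valuation.map_neg, map_inv₀, hav, inv_one, mul_one]; exact ha'

/-! ## §2 The transport `[T⁽ᵈ⁾ : T_c] = [U : V_c]` -/

include he in
/-- **READER'S FORM OF THE IMAGE IDENTITY `T_c = {u∕σu : |u| = 1, |σu − u| ≤ c}`** for `c ≤ D`: `t ∈ T_c ↔ ∃ u, |u| = 1 ∧ |σu − u| ≤ c ∧ t = u∕σu` (★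
`exists_eq_div_of_norm_one_of_valued_sub_one_le` + ★ `valued_div_galAdicCompletionMap_sub_one_le_iff`). [cite: Serre1979, Ch. V §3] [cite: Flicker1998UnitaryFL, Prop. 7 p. 84] -/
theorem mem_normOne_depth_iff_exists_unit {τ : w.1.adicCompletion L} (hτ : Valued.v τ = WithZero.exp (-1 : ℤ)) {c : WithZero (Multiplicative ℤ)}
    (hc : c ≤ Valued.v (galAdicCompletionMap (L := L) (IsCMField.complexConj L) hw τ - τ)) (T₁ : Subgroup (w.1.adicCompletion L)ˣ)
    (hT₁ : ∀ t : (w.1.adicCompletion L)ˣ, t ∈ T₁ ↔ galAdicCompletionMap (L := L) (IsCMField.complexConj L) hw (t : w.1.adicCompletion L) * t = 1 ∧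
      Valued.v ((t : w.1.adicCompletion L) - 1) ≤ c) (t : (w.1.adicCompletion L)ˣ) :
    t ∈ T₁ ↔ ∃ u : w.1.adicCompletion L, Valued.v u = 1 ∧ Valued.v (galAdicCompletionMap (L := L) (IsCMField.complexConj L) hw u - u) ≤ c ∧
      (t : w.1.adicCompletion L) = u / galAdicCompletionMap (L := L) (IsCMField.complexConj L) hw u := by
  rw [hT₁]
  constructor
  · rintro ⟨ht1, htc⟩
    obtain ⟨u, hu, htu⟩ := exists_eq_div_of_norm_one_of_valued_sub_one_le L v w hw he hτ ht1 (htc.trans hc)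
    refine ⟨u, hu, ?_, htu⟩
    rw [← valued_div_galAdicCompletionMap_sub_one_le_iff L v w hw hu, ← htu]; exact htc
  · rintro ⟨u, hu, huc, htu⟩
    have hu0 : u ≠ 0 := fun h => zero_ne_one (by rw [← hu, h, map_zero])
    refine ⟨by rw [htu]; exact galAdicCompletionMap_div_mul_div_eq_one L v w hw hu0, ?_⟩
    rw [htu, valued_div_galAdicCompletionMap_sub_one_le_iff L v w hw hu]; exact huc

include he in
/-- **NORM-ONE INDEX TRANSPORT `[T⁽ᵈ⁾ : T_c] = [U : V_c]`** (general threshold `c ≤ D`).  For hypothesis-characterised subgroups `U = {|u| = 1}`, `V = {|u| = 1, |σu − u| ≤ c}`,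
`T₀ = {σt·t = 1, |t − 1| ≤ D}`, `T₁ = {σt·t = 1, |t − 1| ≤ c}` of `L_wˣ`: `T₁.relIndex T₀ = V.relIndex U`.  (The hom `u ↦ u∕σu` on `↥U` maps `U ↠ T₀`, `V ↠ T₁`, with kernel the
σ-fixed units `⊆ V`; Mathlib `Subgroup.relIndex_map_map`.) [cite: Serre1979, Ch. V §3] [cite: Flicker1998UnitaryFL, Prop. 7 p. 84] -/
theorem relIndex_normOne_eq_relIndex_sigmaDepth_of_le {τ : w.1.adicCompletion L} (hτ : Valued.v τ = WithZero.exp (-1 : ℤ)) {c : WithZero (Multiplicative ℤ)}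
    (hc : c ≤ Valued.v (galAdicCompletionMap (L := L) (IsCMField.complexConj L) hw τ - τ)) (U V T₀ T₁ : Subgroup (w.1.adicCompletion L)ˣ)
    (hU : ∀ u : (w.1.adicCompletion L)ˣ, u ∈ U ↔ Valued.v (u : w.1.adicCompletion L) = 1)
    (hV : ∀ u : (w.1.adicCompletion L)ˣ, u ∈ V ↔ Valued.v (u : w.1.adicCompletion L) = 1 ∧
      Valued.v (galAdicCompletionMap (L := L) (IsCMField.complexConj L) hw (u : w.1.adicCompletion L) - u) ≤ c)
    (hT₀ : ∀ t : (w.1.adicCompletion L)ˣ, t ∈ T₀ ↔ galAdicCompletionMap (L := L) (IsCMField.complexConj L) hw (t : w.1.adicCompletion L) * t = 1 ∧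
      Valued.v ((t : w.1.adicCompletion L) - 1) ≤ Valued.v (galAdicCompletionMap (L := L) (IsCMField.complexConj L) hw τ - τ))
    (hT₁ : ∀ t : (w.1.adicCompletion L)ˣ, t ∈ T₁ ↔ galAdicCompletionMap (L := L) (IsCMField.complexConj L) hw (t : w.1.adicCompletion L) * t = 1 ∧
      Valued.v ((t : w.1.adicCompletion L) - 1) ≤ c) :
    T₁.relIndex T₀ = V.relIndex U := by
  -- `σ` on units and the hom `f : ↥U → L_wˣ`, `u ↦ u / σu`
  set σu : (w.1.adicCompletion L)ˣ →* (w.1.adicCompletion L)ˣ :=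
    Units.map ((galAdicCompletionMap (L := L) (IsCMField.complexConj L) hw : w.1.adicCompletion L →+* w.1.adicCompletion L) :
      w.1.adicCompletion L →* w.1.adicCompletion L) with hσu
  have hσu_val : ∀ x : (w.1.adicCompletion L)ˣ, ((σu x : (w.1.adicCompletion L)ˣ) : w.1.adicCompletion L) =
      galAdicCompletionMap (L := L) (IsCMField.complexConj L) hw (x : w.1.adicCompletion L) := fun x => by
    rw [hσu, Units.coe_map]; rfl
  let f : U →* (w.1.adicCompletion L)ˣ :=
    MonoidHom.mk' (fun u => (u : (w.1.adicCompletion L)ˣ) / σu u) (fun a b => by rw [Subgroup.coe_mul, map_mul, mul_div_mul_comm])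
  have hf : ∀ u : U, ((f u : (w.1.adicCompletion L)ˣ) : w.1.adicCompletion L) =
      ((u : (w.1.adicCompletion L)ˣ) : w.1.adicCompletion L) /
        galAdicCompletionMap (L := L) (IsCMField.complexConj L) hw ((u : (w.1.adicCompletion L)ˣ) : w.1.adicCompletion L) := fun u => by
    change (((u : (w.1.adicCompletion L)ˣ) / σu u : (w.1.adicCompletion L)ˣ) : w.1.adicCompletion L) = _
    rw [Units.val_div_eq_div_val, hσu_val]
  -- a unit of `L_w` of valuation one, as an element of `↥U`
  have hmk : ∀ {u : w.1.adicCompletion L} (hu : Valued.v u = 1), ∃ x : U, ((x : (w.1.adicCompletion L)ˣ) : w.1.adicCompletion L) = u := fun {u} hu => by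
    have hu0 : u ≠ 0 := fun h => zero_ne_one (by rw [← hu, h, map_zero])
    exact ⟨⟨Units.mk0 u hu0, (hU _).2 (by rw [Units.val_mk0]; exact hu)⟩, rfl⟩
  -- `f(U) = T₀`
  have hmap₀ : Subgroup.map f ⊤ = T₀ := by
    ext t
    simp only [Subgroup.mem_map, Subgroup.mem_top, true_and]
    constructor
    · rintro ⟨u, rfl⟩
      have hu1 : Valued.v ((u : (w.1.adicCompletion L)ˣ) : w.1.adicCompletion L) = 1 := (hU _).1 u.2
      refine (hT₀ _).2 ⟨?_, ?_⟩
      · rw [hf]; exact galAdicCompletionMap_div_mul_div_eq_one L v w hw (Units.ne_zero _)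
      · rw [hf]; exact valued_div_galAdicCompletionMap_sub_one_le_of_valued_eq_one L v w hw he hτ hu1
    · intro ht
      obtain ⟨ht1, htd⟩ := (hT₀ t).1 ht
      obtain ⟨u, hu, htu⟩ := exists_eq_div_of_norm_one_of_valued_sub_one_le L v w hw he hτ ht1 htd
      obtain ⟨x, hx⟩ := hmk hu
      exact ⟨x, Units.ext (by rw [hf, hx, htu])⟩
  -- `f(V) = T₁`
  have hmap₁ : Subgroup.map f (V.subgroupOf U) = T₁ := by
    ext t
    simp only [Subgroup.mem_map, Subgroup.mem_subgroupOf]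
    constructor
    · rintro ⟨u, huV, rfl⟩
      obtain ⟨hu1, huc⟩ := (hV _).1 huV
      refine (hT₁ _).2 ⟨?_, ?_⟩
      · rw [hf]; exact galAdicCompletionMap_div_mul_div_eq_one L v w hw (Units.ne_zero _)
      · rw [hf, valued_div_galAdicCompletionMap_sub_one_le_iff L v w hw hu1]; exact huc
    · intro ht
      obtain ⟨u, hu, huc, htu⟩ := (mem_normOne_depth_iff_exists_unit L v w hw he hτ hc T₁ hT₁ t).1 ht
      obtain ⟨x, hx⟩ := hmk hu
      refine ⟨x, (hV _).2 ⟨by rw [hx]; exact hu, by rw [hx]; exact huc⟩, Units.ext (by rw [hf, hx, htu])⟩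
  -- `ker f ⊆ V`: `u∕σu = 1` means `σu = u`, σ-depth `0`
  have hker : f.ker ≤ V.subgroupOf U := by
    intro u hu
    rw [MonoidHom.mem_ker] at hu
    have hu1 : Valued.v ((u : (w.1.adicCompletion L)ˣ) : w.1.adicCompletion L) = 1 := (hU _).1 u.2
    have hσ0 : galAdicCompletionMap (L := L) (IsCMField.complexConj L) hw ((u : (w.1.adicCompletion L)ˣ) : w.1.adicCompletion L) ≠ 0 :=
      (_root_.map_ne_zero _).2 (Units.ne_zero _)
    have hval : ((f u : (w.1.adicCompletion L)ˣ) : w.1.adicCompletion L) = ((1 : (w.1.adicCompletion L)ˣ) : w.1.adicCompletion L) :=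
      congrArg Units.val hu
    rw [hf, Units.val_one, div_eq_one_iff_eq hσ0] at hval
    rw [Subgroup.mem_subgroupOf, hV]
    exact ⟨hu1, by rw [← hval, sub_self, map_zero]; exact zero_le⟩
  -- transport
  have key := Subgroup.relIndex_map_map f (V.subgroupOf U) ⊤
  rw [hmap₁, hmap₀, sup_eq_left.2 hker, top_sup_eq, Subgroup.relIndex_top_right] at key
  rw [key, Subgroup.relIndex]

include he in
/-- **NORM-ONE INDEX TRANSPORT IN THE MARS LETTERS: `[T⁽ᵈ⁾ : T⁽ᵈ⁺²ʲ⁾] = [U : V_j]`** — `V_j = {|u| = 1, |σu − u| ≤ exp(−2j)·D}` (the units of the conductor-`j` order, ★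
`RamifiedPlaceSigmaDepth`), `T_j = {σt·t = 1, |t − 1| ≤ exp(−2j)·D}`: `Tj.relIndex T₀ = V.relIndex U`.  With the MARS index `V.relIndex U = q_v^j` (LH4-p01's
`RamifiedPlaceOrderUnitIndex`) this gives Flicker's Prop. 7 (b) `[R_E¹ : R_E(j)¹] = q^j` at ANY residue characteristic (corollary not stated here).
[cite: Flicker1998UnitaryFL, Prop. 7 p. 84] [cite: Serre1979, Ch. V §3] -/
theorem relIndex_normOne_eq_relIndex_sigmaDepth {τ : w.1.adicCompletion L} (hτ : Valued.v τ = WithZero.exp (-1 : ℤ)) (j : ℕ)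
    (U V T₀ Tj : Subgroup (w.1.adicCompletion L)ˣ)
    (hU : ∀ u : (w.1.adicCompletion L)ˣ, u ∈ U ↔ Valued.v (u : w.1.adicCompletion L) = 1)
    (hV : ∀ u : (w.1.adicCompletion L)ˣ, u ∈ V ↔ Valued.v (u : w.1.adicCompletion L) = 1 ∧
      Valued.v (galAdicCompletionMap (L := L) (IsCMField.complexConj L) hw (u : w.1.adicCompletion L) - u) ≤
        WithZero.exp (-(2 * j : ℤ)) * Valued.v (galAdicCompletionMap (L := L) (IsCMField.complexConj L) hw τ - τ))
    (hT₀ : ∀ t : (w.1.adicCompletion L)ˣ, t ∈ T₀ ↔ galAdicCompletionMap (L := L) (IsCMField.complexConj L) hw (t : w.1.adicCompletion L) * t = 1 ∧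
      Valued.v ((t : w.1.adicCompletion L) - 1) ≤ Valued.v (galAdicCompletionMap (L := L) (IsCMField.complexConj L) hw τ - τ))
    (hTj : ∀ t : (w.1.adicCompletion L)ˣ, t ∈ Tj ↔ galAdicCompletionMap (L := L) (IsCMField.complexConj L) hw (t : w.1.adicCompletion L) * t = 1 ∧
      Valued.v ((t : w.1.adicCompletion L) - 1) ≤
        WithZero.exp (-(2 * j : ℤ)) * Valued.v (galAdicCompletionMap (L := L) (IsCMField.complexConj L) hw τ - τ)) :
    Tj.relIndex T₀ = V.relIndex U := by
  refine relIndex_normOne_eq_relIndex_sigmaDepth_of_le L v w hw he hτ ?_ U V T₀ Tj hU hV hT₀ hTj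
  refine mul_le_of_le_one_left zero_le ?_
  rw [← WithZero.exp_zero, WithZero.exp_le_exp]; omega

/-! ## §3 The Hilbert-90 index `[T : T⁽ᵈ⁾] = 2` -/

include he in
/-- **`[T : T⁽ᵈ⁾] = 2`**: for `T = {σt·t = 1}` and `T₀ = {σt·t = 1, |t − 1| ≤ D}`, `T₀.relIndex T = 2` — the coset representative is `a = τ∕στ` (depth `d − 1`): every `b ∈ T` is
`u∕σu ∈ T₀` or `u∕σu · a ∉ T₀` (★ `exists_eq_div_or_of_norm_one`, depths `≤ D` vs `= D·e`), and `b ↦ b·a` switches the two kinds (`σa = a⁻¹`, so `(u∕σu)·a·a = (ua)∕σ(ua)`).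
[cite: Serre1979, Ch. X §1 Prop. 2, Ch. V §3] [cite: Flicker1998UnitaryFL, Prop. 7 p. 84] -/
theorem relIndex_normOne_depth_eq_two {τ : w.1.adicCompletion L} (hτ : Valued.v τ = WithZero.exp (-1 : ℤ)) (T T₀ : Subgroup (w.1.adicCompletion L)ˣ)
    (hT : ∀ t : (w.1.adicCompletion L)ˣ, t ∈ T ↔ galAdicCompletionMap (L := L) (IsCMField.complexConj L) hw (t : w.1.adicCompletion L) * t = 1)
    (hT₀ : ∀ t : (w.1.adicCompletion L)ˣ, t ∈ T₀ ↔ galAdicCompletionMap (L := L) (IsCMField.complexConj L) hw (t : w.1.adicCompletion L) * t = 1 ∧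
      Valued.v ((t : w.1.adicCompletion L) - 1) ≤ Valued.v (galAdicCompletionMap (L := L) (IsCMField.complexConj L) hw τ - τ)) :
    T₀.relIndex T = 2 := by
  have hτ0 : τ ≠ 0 := fun h => by rw [h, map_zero] at hτ; exact WithZero.zero_ne_coe hτ
  have hστ0 : galAdicCompletionMap (L := L) (IsCMField.complexConj L) hw τ ≠ 0 := (_root_.map_ne_zero _).2 hτ0
  have hD0 := valued_galAdicCompletionMap_sub_self_ne_zero L v w hw he hτ
  -- the representative `a = τ / στ`
  set a : (w.1.adicCompletion L)ˣ := Units.mk0 (τ / galAdicCompletionMap (L := L) (IsCMField.complexConj L) hw τ) (div_ne_zero hτ0 hστ0) with ha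
  have haK : (a : w.1.adicCompletion L) = τ / galAdicCompletionMap (L := L) (IsCMField.complexConj L) hw τ := Units.val_mk0 _
  have ha1 : galAdicCompletionMap (L := L) (IsCMField.complexConj L) hw (a : w.1.adicCompletion L) * a = 1 := by
    rw [haK]; exact galAdicCompletionMap_div_mul_div_eq_one L v w hw hτ0
  have haT : a ∈ T := (hT a).2 ha1
  have hav : Valued.v (a : w.1.adicCompletion L) = 1 := valued_eq_one_of_norm_one' L v w hw ha1
  have hσa : galAdicCompletionMap (L := L) (IsCMField.complexConj L) hw (a : w.1.adicCompletion L) = ((a : w.1.adicCompletion L))⁻¹ := by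
    rw [haK, map_div₀, galAdicCompletionMap_galAdicCompletionMap'' L v w hw, inv_div]
  rw [Subgroup.relIndex_eq_two_iff]
  refine ⟨a, haT, fun b hb => ?_⟩
  have hb1 := (hT b).1 hb
  obtain ⟨u, hu, hbu | hbu⟩ := exists_eq_div_or_of_norm_one L v w hw he hτ hb1
  · -- first kind: `b ∈ T₀`, `b·a ∉ T₀`
    refine Or.inr ⟨(hT₀ b).2 ⟨hb1, by rw [hbu]; exact valued_div_galAdicCompletionMap_sub_one_le_of_valued_eq_one L v w hw he hτ hu⟩, fun hba => ?_⟩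
    obtain ⟨-, hd⟩ := (hT₀ _).1 hba
    rw [Units.val_mul, haK, hbu, valued_div_galAdicCompletionMap_mul_sub_one_of_valued_eq_one L v w hw he hτ hu] at hd
    exact absurd hd (not_le.2 (lt_mul_exp_one' hD0))
  · -- second kind: `b·a ∈ T₀`, `b ∉ T₀`
    have hσu0 : galAdicCompletionMap (L := L) (IsCMField.complexConj L) hw u ≠ 0 :=
      (_root_.map_ne_zero _).2 (fun h => zero_ne_one (by rw [← hu, h, map_zero]))
    refine Or.inl ⟨(hT₀ _).2 ⟨?_, ?_⟩, fun hb0 => ?_⟩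
    · rw [Units.val_mul, map_mul]
      calc _ = (galAdicCompletionMap (L := L) (IsCMField.complexConj L) hw (b : w.1.adicCompletion L) * b) *
            (galAdicCompletionMap (L := L) (IsCMField.complexConj L) hw (a : w.1.adicCompletion L) * a) := by ring
        _ = 1 := by rw [hb1, ha1, one_mul]
    · have hua : Valued.v (u * a) = 1 := by rw [map_mul, hu, hav, one_mul]
      have hba : ((b * a : (w.1.adicCompletion L)ˣ) : w.1.adicCompletion L) =
          u * a / galAdicCompletionMap (L := L) (IsCMField.complexConj L) hw (u * a) := by
        rw [Units.val_mul, hbu, map_mul, hσa, haK]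
        field_simp
      rw [hba]; exact valued_div_galAdicCompletionMap_sub_one_le_of_valued_eq_one L v w hw he hτ hua
    · obtain ⟨-, hd⟩ := (hT₀ b).1 hb0
      rw [hbu, valued_div_galAdicCompletionMap_mul_sub_one_of_valued_eq_one L v w hw he hτ hu] at hd
      exact absurd hd (not_le.2 (lt_mul_exp_one' hD0))

/-! ## §4 (ED. 2) `[T⁽ᵈ⁾ : T⁽ᵈ⁺²ʲ⁾] = q_v^j` and `[T : T⁽ᵈ⁺²ʲ⁾] = 2·q_v^j` — Flicker's Prop. 7 (b) at ANY residue characteristic, over the MARS index ★ `RamifiedPlaceOrderUnitIndex` -/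

include he in
/-- **`[T⁽ᵈ⁾ : T⁽ᵈ⁺²ʲ⁾] = q_v^j`** (`q_v = #𝓀(L⁺_v)`): for `T₀ = {σt·t = 1, |t − 1| ≤ D}` and `T_j = {σt·t = 1, |t − 1| ≤ exp(−2j)·D}` (`D = |στ − τ|`), `Tj.relIndex T₀ = Nat.card 𝓀[L⁺_v] ^ j` —
§2's transport `[T⁽ᵈ⁾ : T⁽ᵈ⁺²ʲ⁾] = [𝒪_wˣ : (𝒪_v + ϖ_v^j 𝒪_w)ˣ]` composed with the MARS index ★ `relIndex_eq_pow_of_sigmaDepth` (the unit groups `U`, `V_j` are obtained from ★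
`exists_subgroup_units_valued_eq_one` ∕ ★ `exists_subgroup_sigmaDepth` and do not appear in the statement).  This is Flicker's `[R_E¹ : R_E(j)¹] = q^j` (Prop. 7 (b), there `p > 2`,
tame `d = 1`) at every ramified CM place, any residue characteristic. [cite: Flicker1998UnitaryFL, Prop. 7 p. 84] [cite: Serre1979, Ch. V §3] -/
theorem relIndex_normOne_eq_pow {τ : w.1.adicCompletion L} (hτ : Valued.v τ = WithZero.exp (-1 : ℤ)) (j : ℕ) (T₀ Tj : Subgroup (w.1.adicCompletion L)ˣ)
    (hT₀ : ∀ t : (w.1.adicCompletion L)ˣ, t ∈ T₀ ↔ galAdicCompletionMap (L := L) (IsCMField.complexConj L) hw (t : w.1.adicCompletion L) * t = 1 ∧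
      Valued.v ((t : w.1.adicCompletion L) - 1) ≤ Valued.v (galAdicCompletionMap (L := L) (IsCMField.complexConj L) hw τ - τ))
    (hTj : ∀ t : (w.1.adicCompletion L)ˣ, t ∈ Tj ↔ galAdicCompletionMap (L := L) (IsCMField.complexConj L) hw (t : w.1.adicCompletion L) * t = 1 ∧
      Valued.v ((t : w.1.adicCompletion L) - 1) ≤
        WithZero.exp (-(2 * j : ℤ)) * Valued.v (galAdicCompletionMap (L := L) (IsCMField.complexConj L) hw τ - τ)) :
    Tj.relIndex T₀ = Nat.card 𝓀[v.adicCompletion ↥(maximalRealSubfield L)] ^ j := by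
  obtain ⟨U, hU⟩ := exists_subgroup_units_valued_eq_one L v w
  obtain ⟨V, hV⟩ := exists_subgroup_sigmaDepth L v w hw
    (WithZero.exp (-(2 * j : ℤ)) * Valued.v (galAdicCompletionMap (L := L) (IsCMField.complexConj L) hw τ - τ))
  rw [relIndex_normOne_eq_relIndex_sigmaDepth L v w hw he hτ j U V T₀ Tj hU hV hT₀ hTj]
  exact relIndex_eq_pow_of_sigmaDepth L v w hw he hτ j U V hU hV

include he in
/-- The same index read with the absolute norm: `[T⁽ᵈ⁾ : T⁽ᵈ⁺²ʲ⁾] = #(𝓞_{L⁺} ∕ v) ^ j` (★ `relIndex_eq_absNorm_pow_of_sigmaDepth`). [cite: Flicker1998UnitaryFL, Prop. 7 p. 84] [cite: NeukirchANT1999, Ch. I §12] -/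
theorem relIndex_normOne_eq_absNorm_pow {τ : w.1.adicCompletion L} (hτ : Valued.v τ = WithZero.exp (-1 : ℤ)) (j : ℕ) (T₀ Tj : Subgroup (w.1.adicCompletion L)ˣ)
    (hT₀ : ∀ t : (w.1.adicCompletion L)ˣ, t ∈ T₀ ↔ galAdicCompletionMap (L := L) (IsCMField.complexConj L) hw (t : w.1.adicCompletion L) * t = 1 ∧
      Valued.v ((t : w.1.adicCompletion L) - 1) ≤ Valued.v (galAdicCompletionMap (L := L) (IsCMField.complexConj L) hw τ - τ))
    (hTj : ∀ t : (w.1.adicCompletion L)ˣ, t ∈ Tj ↔ galAdicCompletionMap (L := L) (IsCMField.complexConj L) hw (t : w.1.adicCompletion L) * t = 1 ∧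
      Valued.v ((t : w.1.adicCompletion L) - 1) ≤
        WithZero.exp (-(2 * j : ℤ)) * Valued.v (galAdicCompletionMap (L := L) (IsCMField.complexConj L) hw τ - τ)) :
    Tj.relIndex T₀ = Nat.card (𝓞 ↥(maximalRealSubfield L) ⧸ v.asIdeal) ^ j := by
  obtain ⟨U, hU⟩ := exists_subgroup_units_valued_eq_one L v w
  obtain ⟨V, hV⟩ := exists_subgroup_sigmaDepth L v w hw
    (WithZero.exp (-(2 * j : ℤ)) * Valued.v (galAdicCompletionMap (L := L) (IsCMField.complexConj L) hw τ - τ))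
  rw [relIndex_normOne_eq_relIndex_sigmaDepth L v w hw he hτ j U V T₀ Tj hU hV hT₀ hTj]
  exact relIndex_eq_absNorm_pow_of_sigmaDepth L v w hw he hτ j U V hU hV

include he in
/-- **THE FULL NORM-ONE FILTRATION INDEX `[T : T⁽ᵈ⁺²ʲ⁾] = 2 · q_v^j`**: `T = {σt·t = 1}`, `T_j = {σt·t = 1, |t − 1| ≤ exp(−2j)·D}` — the Hilbert-90 index `[T : T⁽ᵈ⁾] = 2` (§3) times
`[T⁽ᵈ⁾ : T⁽ᵈ⁺²ʲ⁾] = q_v^j` (Mathlib `Subgroup.relIndex_mul_relIndex` along `T_j ≤ T₀ ≤ T`, `T₀` obtained from ★ `exists_subgroup_normOne_depth`). [cite: Flicker1998UnitaryFL, Prop. 7 p. 84] [cite: Serre1979, Ch. V §3, Ch. X §1] -/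
theorem relIndex_normOne_top_eq_two_mul_pow {τ : w.1.adicCompletion L} (hτ : Valued.v τ = WithZero.exp (-1 : ℤ)) (j : ℕ) (T Tj : Subgroup (w.1.adicCompletion L)ˣ)
    (hT : ∀ t : (w.1.adicCompletion L)ˣ, t ∈ T ↔ galAdicCompletionMap (L := L) (IsCMField.complexConj L) hw (t : w.1.adicCompletion L) * t = 1)
    (hTj : ∀ t : (w.1.adicCompletion L)ˣ, t ∈ Tj ↔ galAdicCompletionMap (L := L) (IsCMField.complexConj L) hw (t : w.1.adicCompletion L) * t = 1 ∧
      Valued.v ((t : w.1.adicCompletion L) - 1) ≤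
        WithZero.exp (-(2 * j : ℤ)) * Valued.v (galAdicCompletionMap (L := L) (IsCMField.complexConj L) hw τ - τ)) :
    Tj.relIndex T = 2 * Nat.card 𝓀[v.adicCompletion ↥(maximalRealSubfield L)] ^ j := by
  obtain ⟨T₀, hT₀⟩ := exists_subgroup_normOne_depth L v w hw (Valued.v (galAdicCompletionMap (L := L) (IsCMField.complexConj L) hw τ - τ))
  have hle : WithZero.exp (-(2 * j : ℤ)) * Valued.v (galAdicCompletionMap (L := L) (IsCMField.complexConj L) hw τ - τ) ≤
      Valued.v (galAdicCompletionMap (L := L) (IsCMField.complexConj L) hw τ - τ) := by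
    refine mul_le_of_le_one_left zero_le ?_
    rw [← WithZero.exp_zero, WithZero.exp_le_exp]; omega
  have hTjT₀ : Tj ≤ T₀ := fun t ht => (hT₀ t).2 ⟨((hTj t).1 ht).1, ((hTj t).1 ht).2.trans hle⟩
  have hT₀T : T₀ ≤ T := fun t ht => (hT t).2 ((hT₀ t).1 ht).1
  rw [← Subgroup.relIndex_mul_relIndex Tj T₀ T hTjT₀ hT₀T, relIndex_normOne_eq_pow L v w hw he hτ j T₀ Tj hT₀ hTj,
    relIndex_normOne_depth_eq_two L v w hw he hτ T T₀ hT hT₀, mul_comm]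

include he in
/-- **ONE PACKAGE** (existence form): for every `j` there are subgroups `T_j ≤ T₀ ≤ T ≤ L_wˣ` — the norm-one torus, its depth-`d` ball and its depth-`(d+2j)` ball — with
`[T : T₀] = 2` and `[T₀ : T_j] = q_v^j`. [cite: Flicker1998UnitaryFL, Prop. 7 p. 84] [cite: Serre1979, Ch. V §3, Ch. X §1] -/
theorem exists_subgroups_normOne_relIndex {τ : w.1.adicCompletion L} (hτ : Valued.v τ = WithZero.exp (-1 : ℤ)) (j : ℕ) :
    ∃ T T₀ Tj : Subgroup (w.1.adicCompletion L)ˣ,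
      (∀ t : (w.1.adicCompletion L)ˣ, t ∈ T ↔ galAdicCompletionMap (L := L) (IsCMField.complexConj L) hw (t : w.1.adicCompletion L) * t = 1) ∧
      (∀ t : (w.1.adicCompletion L)ˣ, t ∈ T₀ ↔ galAdicCompletionMap (L := L) (IsCMField.complexConj L) hw (t : w.1.adicCompletion L) * t = 1 ∧
        Valued.v ((t : w.1.adicCompletion L) - 1) ≤ Valued.v (galAdicCompletionMap (L := L) (IsCMField.complexConj L) hw τ - τ)) ∧
      (∀ t : (w.1.adicCompletion L)ˣ, t ∈ Tj ↔ galAdicCompletionMap (L := L) (IsCMField.complexConj L) hw (t : w.1.adicCompletion L) * t = 1 ∧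
        Valued.v ((t : w.1.adicCompletion L) - 1) ≤
          WithZero.exp (-(2 * j : ℤ)) * Valued.v (galAdicCompletionMap (L := L) (IsCMField.complexConj L) hw τ - τ)) ∧
      Tj ≤ T₀ ∧ T₀ ≤ T ∧ T₀.relIndex T = 2 ∧ Tj.relIndex T₀ = Nat.card 𝓀[v.adicCompletion ↥(maximalRealSubfield L)] ^ j := by
  obtain ⟨T, hT⟩ := exists_subgroup_normOne L v w hw
  obtain ⟨T₀, hT₀⟩ := exists_subgroup_normOne_depth L v w hw (Valued.v (galAdicCompletionMap (L := L) (IsCMField.complexConj L) hw τ - τ))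
  obtain ⟨Tj, hTj⟩ := exists_subgroup_normOne_depth L v w hw
    (WithZero.exp (-(2 * j : ℤ)) * Valued.v (galAdicCompletionMap (L := L) (IsCMField.complexConj L) hw τ - τ))
  have hle : WithZero.exp (-(2 * j : ℤ)) * Valued.v (galAdicCompletionMap (L := L) (IsCMField.complexConj L) hw τ - τ) ≤
      Valued.v (galAdicCompletionMap (L := L) (IsCMField.complexConj L) hw τ - τ) := by
    refine mul_le_of_le_one_left zero_le ?_
    rw [← WithZero.exp_zero, WithZero.exp_le_exp]; omega
  exact ⟨T, T₀, Tj, hT, hT₀, hTj, fun t ht => (hT₀ t).2 ⟨((hTj t).1 ht).1, ((hTj t).1 ht).2.trans hle⟩, fun t ht => (hT t).2 ((hT₀ t).1 ht).1,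
    relIndex_normOne_depth_eq_two L v w hw he hτ T T₀ hT hT₀, relIndex_normOne_eq_pow L v w hw he hτ j T₀ Tj hT₀ hTj⟩

end Literature.NumberTheory.Automorphic.UnitaryGroup

end
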